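import Summits.KontsevichZagierPeriods.KontsevichZagierPeriods.Theses.GenusOneIterated

/-! Strategist sketch (cstrat-stmt-KontsevichZagierPeriods-6776-s2): typed companions of the crux `DepthThreeFamily`.
`SecondLyndonFamily` = the (L2)-family defect `D₂(e) ∈ KZ.relations` (census S1, intended witness of `stub_framedTransport`);
`BFreeQuadraticCompanion` = (L3) = η₁(L1) − (L2): B-period-free, log-free, integer-coefficient quadratic relation (census F2/S3,
crux idea `bfree-quadratic-companion`). Both verified numerically to ≤ 1e−12 on five moduli (`num/check_L123.py`). -/

namespace Summit.KontsevichZagierPeriods.KontsevichZagierPeriods.Cruxes.DepthThreeFamily.FlatFrame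

/-- (L2)-family: `24[rA][r₂] − 4[rA]²[rB]² − 2[π][rB][rA'] − [π]² − 12[rA][rB] + [rA][rB][rL₂] ∈ KZ.relations` for every
admissible modulus (`r₂ = I(ωηη)`, `rL₂` unfolded `8log2 − 2log(e₁−e₃) + 4log(e₁−e₂) − 2log(e₂−e₃)`). [strategist, unproved] -/
def SecondLyndonFamily : Prop :=
  ∀ (e₁ e₂ e₃ : ℝ), IsAlgebraic ℚ e₁ → IsAlgebraic ℚ e₂ → IsAlgebraic ℚ e₃ → e₃ < e₂ → e₂ < e₁ → e₁ + e₂ + e₃ = 0 → ∀ (r₂ : Literature.NumberTheory.Transcendental.KZ.IntegralRep 3) (rA rB rA' rL₂ : Literature.NumberTheory.Transcendental.KZ.IntegralRep 1), r₂.domain = {x | e₃ < x 0 ∧ x 0 < x 1 ∧ x 1 < x 2 ∧ x 2 < e₂} → Set.EqOn r₂.integrand (fun x => x 1 * x 2 / (Real.sqrt (4 * (x 0 - e₁) * (x 0 - e₂) * (x 0 - e₃)) * Real.sqrt (4 * (x 1 - e₁) * (x 1 - e₂) * (x 1 - e₃)) * Real.sqrt (4 * (x 2 - e₁) * (x 2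 - e₂) * (x 2 - e₃)))) r₂.domain → rA.domain = {x | e₃ < x 0 ∧ x 0 < e₂} → Set.EqOn rA.integrand (fun x => 1 / Real.sqrt (4 * (x 0 - e₁) * (x 0 - e₂) * (x 0 - e₃))) rA.domain → rB.domain = {x | e₃ < x 0 ∧ x 0 < e₂} → Set.EqOn rB.integrand (fun x => x 0 / Real.sqrt (4 * (x 0 - e₁) * (x 0 - e₂) * (x 0 - e₃))) rB.domain → rA'.domain = {x | e₂ < x 0 ∧ x 0 < e₁} → Set.EqOn rA'.integrand (fun x => 1 / Real.sqrt (-(4 * (x 0 - e₁) * (x 0 - e₂) * (x 0 - e₃)))) rA'.domain → rL₂.domain = {x | 0 < x 0 ∧ x 0 < 1} → Set.EqOn rL₂.integrand (fun x => 8 / (1 + x 0) - 2 * (e₁ - e₃ - 1) / (1 + (e₁ - e₃ - 1) * x 0) + 4 * (e₁ - e₂ - 1) / (1 + (e₁ - e₂ - 1) * x 0) - 2 * (e₂ - e₃ - 1) / (1 + (e₂ - e₃ - 1) * x 0)) rL₂.domain → 24 • (Literature.NumberTheory.Transcendental.KZ.of rA * Literature.NumberTheory.Transcendental.KZ.of r₂)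 - 4 • (Literature.NumberTheory.Transcendental.KZ.of rA * Literature.NumberTheory.Transcendental.KZ.of rA * Literature.NumberTheory.Transcendental.KZ.of rB * Literature.NumberTheory.Transcendental.KZ.of rB) - 2 • (Literature.NumberTheory.Transcendental.KZ.of Literature.NumberTheory.Transcendental.KZ.piRep * Literature.NumberTheory.Transcendental.KZ.of rB * Literature.NumberTheory.Transcendental.KZ.of rA') - Literature.NumberTheory.Transcendental.KZ.of Literature.NumberTheory.Transcendental.KZ.piRep * Literature.NumberTheory.Transcendental.KZ.of Literature.NumberTheory.Transcendental.KZ.piRep - 12 • (Literature.NumberTheory.Transcendental.KZ.of rA * Literature.NumberTheory.Transcendental.KZ.of rB) + Literature.NumberTheory.Transcendental.KZ.of rA * Literature.NumberTheory.Transcendental.KZ.of rB * Literature.NumberTheory.Transcendental.KZ.of rL₂ ∈ Literature.NumberTheory.Transcendental.KZ.relations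

/-- (L3): `24[rB][r] + 24[rA][r₂] − 8[rA]²[rB]² − [π]² − 12[rA][rB] − 12[rA][rB][rK] ∈ KZ.relations`, `rK` the KummerFamily
triangle rep (value `½log((e₁−e₃)/(e₁−e₂))`). A-arc data and `[π]²` only. [strategist, unproved] -/
def BFreeQuadraticCompanion : Prop :=
  ∀ (e₁ e₂ e₃ : ℝ), IsAlgebraic ℚ e₁ → IsAlgebraic ℚ e₂ → IsAlgebraic ℚ e₃ → e₃ < e₂ → e₂ < e₁ → e₁ + e₂ + e₃ = 0 → ∀ (r r₂ : Literature.NumberTheory.Transcendental.KZ.IntegralRep 3) (rK : Literature.NumberTheory.Transcendental.KZ.IntegralRep 2) (rA rB : Literature.NumberTheory.Transcendental.KZ.IntegralRep 1), r.domain = {x | e₃ < x 0 ∧ x 0 < x 1 ∧ x 1 < x 2 ∧ x 2 < e₂} → Set.EqOn r.integrand (fun x => x 2 / (Real.sqrt (4 * (x 0 - e₁) * (x 0 - e₂) * (x 0 - e₃)) * Real.sqrt (4 * (x 1 - e₁) * (x 1 - e₂) * (x 1 - e₃)) * Real.sqrt (4 * (x 2 - e₁) * (x 2 - e₂) * (x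 2 - e₃)))) r.domain → r₂.domain = {x | e₃ < x 0 ∧ x 0 < x 1 ∧ x 1 < x 2 ∧ x 2 < e₂} → Set.EqOn r₂.integrand (fun x => x 1 * x 2 / (Real.sqrt (4 * (x 0 - e₁) * (x 0 - e₂) * (x 0 - e₃)) * Real.sqrt (4 * (x 1 - e₁) * (x 1 - e₂) * (x 1 - e₃)) * Real.sqrt (4 * (x 2 - e₁) * (x 2 - e₂) * (x 2 - e₃)))) r₂.domain → rK.domain = {x | e₃ < x 0 ∧ x 0 < x 1 ∧ x 1 < e₂} → Set.EqOn rK.integrand (fun x => (x 1 - x 0) / (Real.sqrt (4 * (x 0 - e₁) * (x 0 - e₂) * (x 0 - e₃)) * Real.sqrt (4 * (x 1 - e₁) * (x 1 - e₂) * (x 1 - e₃)))) rK.domain → rA.domain = {x | e₃ < x 0 ∧ x 0 < e₂} → Set.EqOn rA.integrand (fun x => 1 / Real.sqrt (4 * (x 0 - e₁) * (x 0 - e₂) * (x 0 - e₃))) rA.domain → rB.domain = {x | e₃ < x 0 ∧ x 0 < e₂} → Set.EqOn rB.integrand (fun x => x 0 / Real.sqrt (4 * (x 0 - e₁) * (x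 0 - e₂) * (x 0 - e₃))) rB.domain → 24 • (Literature.NumberTheory.Transcendental.KZ.of rB * Literature.NumberTheory.Transcendental.KZ.of r) + 24 • (Literature.NumberTheory.Transcendental.KZ.of rA * Literature.NumberTheory.Transcendental.KZ.of r₂) - 8 • (Literature.NumberTheory.Transcendental.KZ.of rA * Literature.NumberTheory.Transcendental.KZ.of rA * Literature.NumberTheory.Transcendental.KZ.of rB * Literature.NumberTheory.Transcendental.KZ.of rB) - Literature.NumberTheory.Transcendental.KZ.of Literature.NumberTheory.Transcendental.KZ.piRep * Literature.NumberTheory.Transcendental.KZ.of Literature.NumberTheory.Transcendental.KZ.piRep - 12 • (Literature.NumberTheory.Transcendental.KZ.of rA * Literature.NumberTheory.Transcendental.KZ.of rB) - 12 • (Literature.NumberTheory.Transcendental.KZ.of rA * Literature.NumberTheory.Transcendental.KZ.of rB * Literature.NumberTheory.Transcendental.KZ.of rK) ∈ Literature.NumberTheory.Transcendental.KZ.relations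

end Summit.KontsevichZagierPeriods.KontsevichZagierPeriods.Cruxes.DepthThreeFamily.FlatFrame
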